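import Summits.Ventures.HodgeRepro2.T5IsotypicInvariantsFinite
import Summits.Ventures.HodgeRepro2.T5FiniteCopiesModule
import Summits.Ventures.HodgeRepro2.T5IsotypicComponentBound

/-!
# T5IsotypicDimensionBound — (A3) STEP 5 end to end on the Hilbert model:
«dim π₀^{K_f}[τ] ≤ m_{K_f}(π_∞) · dim (H_{π_∞})_τ < ∞»

Cell pub-hodge-repro2, seat p5, Tier 5 (route/T5-N4-p5.md, N4.3 v13 (A3) STEP 5, l. 147).  The three
kernel pieces composed: row 76 (`T5IsotypicInvariantsFinite.inf_eq_sSup_of_decomposition`: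
`L_π ⊓ L^{K_f} = sSup S_π` with `S_π` FINITE and every member a copy of `H_π` through an intertwining
isometry), row 78 (`T5FiniteCopiesModule.copiesModuleEquiv`: such a finite orthogonal family of
intertwining copies is `S_π → H_π` as a `ℂ[K]`-module) and row 77′
(`T5IsotypicComponentBound.finrank_isotypicComponent_le_of_equiv_pi`: the `τ`-isotypic dimension
of every `ℂ[K]`-submodule of `S_π → H_π` is at most `#S_π · dim H_π[τ]`).

Setting: `ρ : G →* (E →L[ℂ] E)` unitary («R restricted to G_∞»), the isotypic data of row 37
(`σ π` pairwise inequivalent irreducible unitary on `F π`, closed stable copies `H π i` with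
intertwining isometries `U π i`, dense span), a decomposition `S` of a closed subspace `Fx`
(«L^{K_f}»: irreducible closed stable members, pairwise orthogonal, dense sum, finite
unitary-equivalence classes — rows 53 / 65 / 72 / 75), an index `π` («π_∞»), a group `K` with
`κ : K →* G` («K_∞ ⊂ G_∞»), and a simple `ℂ[K]`-module `T` («the K_∞-type τ»).

* `iSup_stable_of_mem`: the sum `⨆ j : S_π, j` of the members of the decomposition lying in `L π` is
  `ρ`-stable, hence `ρ ∘ κ`-stable — `sumRep` is the subrepresentation of `toRep (ρ.comp κ)` on it;
* `iSup_eq_inf`: that sum IS `L π ⊓ Fx` («L_{π_∞} ∩ L^{K_f}»);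
* `exists_copiesModuleEquiv`: `sumRep.asModule ≃ₗ[ℂ[K]] (S_π → (toRep ((σ π).comp κ)).asModule)`
  (row 76's copies fed to row 78);
* **`finite_and_finrank_isotypicComponent_le`**: if `H_π[T]` is finite-dimensional (admissibility of
  `π_∞`, [KV] Thm 0.3, (A2)), then EVERY `ℂ[K]`-submodule `W'` of `sumRep.asModule` («π₀^{K_f}»,
  which lies in `L_{π_∞} ∩ L^{K_f}` by STEP 4) has `W'[T]` finite-dimensional with
  `dim_ℂ W'[T] ≤ Nat.card S_π · dim_ℂ H_π[T]` — the displayed inequality, `m_{K_f}(π_∞) = #S_π`.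

What stays prose: the identification of the abstract data with `L = L²([U(W_A)])`, `G = G_∞`,
`K = K_∞`, `Fx = L^{K_f}` (rows 19 / 75 supply `L^{K_f}` and its decomposition on the abstract
model), STEP 4's «π₀ ⊂ L_{π_∞}» (row 79 in the two-group form), and admissibility itself.
Imports rows 76 / 78 / 77′ (and rows 16 / 25 / 33 / 35 / 37 / 38 / 49 / 53 / 71 / 72 through them).
Axioms: propext, Classical.choice, Quot.sound.  README §8(d): uses an L-value-free non-vanishing
device: NO.
-/

namespace Summit.Ventures.HodgeRepro2.T5IsotypicDimensionBound

open scoped InnerProductSpace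
open Summit.Ventures.HodgeRepro2.T5CompactDiscreteDecomposition (IrreducibleOn)
open Summit.Ventures.HodgeRepro2.T5FiniteMultiplicity (IsUnitaryEquiv)
open Summit.Ventures.HodgeRepro2.T5IsotypicInvariantsFinite (inf_eq_sSup_of_decomposition)
open Summit.Ventures.HodgeRepro2.T5FiniteCopiesModule (toRep sumSubrep copiesModuleEquiv)
open Summit.Ventures.HodgeRepro2.T5IsotypicComponentBound (finrank_isotypicComponent_le_of_equiv_pi)

variable {E : Type*} [NormedAddCommGroup E] [InnerProductSpace ℂ E] [CompleteSpace E]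
variable {G : Type*} [Group G]

omit [CompleteSpace E] in
/-- The sum of a family of `ρ`-stable subspaces is `ρ`-stable (`toRep` form, for a homomorphism
`κ : K →* G`). -/
theorem iSup_stable_of_forall {K : Type*} [Group K] (ρ : G →* (E →L[ℂ] E)) (κ : K →* G)
    {ι : Type*} (W : ι → Submodule ℂ E) (hW : ∀ i g, ∀ x ∈ W i, ρ g x ∈ W i) (k : K) :
    (⨆ i, W i) ≤ (⨆ i, W i).comap (toRep (ρ.comp κ) k) := by
  intro x hx
  rw [Submodule.mem_comap]
  refine Submodule.iSup_induction W (motive := fun y => toRep (ρ.comp κ) k y ∈ ⨆ i, W i) hx ?_ ?_ ?_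
  · intro i y hy
    exact Submodule.mem_iSup_of_mem i (hW i (κ k) y hy)
  · simp
  · intro y z hy hz
    rw [map_add]
    exact Submodule.add_mem _ hy hz

section Decomposition

variable {P : Type*} {F : P → Type*} [∀ π, NormedAddCommGroup (F π)]
  [∀ π, InnerProductSpace ℂ (F π)] [∀ π, CompleteSpace (F π)]

/-- The members of the decomposition `S` lying in the isotypic part `L π` («S_π»). -/
def members (S : Set (Submodule ℂ E)) {ι : P → Type*} (H : ∀ π, ι π → Submodule ℂ E) (π : P) :
    Set (Submodule ℂ E) :=
  {W ∈ S | W ≤ (⨆ i, H π i).topologicalClosure}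

omit [CompleteSpace E] in
/-- The members of a decomposition (irreducible closed stable subspaces) are `ρ`-stable, so their
sum is `ρ ∘ κ`-stable. -/
theorem iSup_members_stable {K : Type*} [Group K] {ρ : G →* (E →L[ℂ] E)} (κ : K →* G)
    {S : Set (Submodule ℂ E)} (hS : ∀ W ∈ S, IrreducibleOn ρ W) {ι : P → Type*}
    (H : ∀ π, ι π → Submodule ℂ E) (π : P) (k : K) :
    (⨆ j : members S H π, (j : Submodule ℂ E)) ≤
      (⨆ j : members S H π, (j : Submodule ℂ E)).comap (toRep (ρ.comp κ) k) :=
  iSup_stable_of_forall ρ κ (fun j : members S H π => (j : Submodule ℂ E))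
    (fun j g => (hS j j.2.1).2.1 g) k

/-- The representation of `K` on `L_π ⊓ L^{K_f} = ⨆ S_π` («the K_∞-action on the m copies of
H_{π_∞}»): the subrepresentation of `toRep (ρ.comp κ)`. -/
noncomputable def sumRep {K : Type*} [Group K] {ρ : G →* (E →L[ℂ] E)} (κ : K →* G)
    {S : Set (Submodule ℂ E)} (hS : ∀ W ∈ S, IrreducibleOn ρ W) {ι : P → Type*}
    (H : ∀ π, ι π → Submodule ℂ E) (π : P) :
    Representation ℂ K ↥(⨆ j : members S H π, (j : Submodule ℂ E)) :=
  (toRep (ρ.comp κ)).subrepresentation _ (iSup_members_stable κ hS H π)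

omit [CompleteSpace E] in
/-- `sumRep … k w = ρ (κ k) w` in `E`. -/
@[simp] theorem coe_sumRep_apply {K : Type*} [Group K] {ρ : G →* (E →L[ℂ] E)} (κ : K →* G)
    {S : Set (Submodule ℂ E)} (hS : ∀ W ∈ S, IrreducibleOn ρ W) {ι : P → Type*}
    (H : ∀ π, ι π → Submodule ℂ E) (π : P) (k : K)
    (w : ↥(⨆ j : members S H π, (j : Submodule ℂ E))) :
    (sumRep κ hS H π k w : E) = ρ (κ k) w := rfl

/-- **«L_{π_∞} ∩ L^{K_f}» is the sum of the members lying in `L_{π_∞}`** (row 76, restated for the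
indexed sum `⨆ j : S_π, j`). -/
theorem iSup_eq_inf {ρ : G →* (E →L[ℂ] E)} (hρ : ∀ g, star (ρ g) = ρ g⁻¹)
    (σ : ∀ π, G →* (F π →L[ℂ] F π)) (hσ : ∀ π g, star (σ π g) = σ π g⁻¹)
    (hσirr : ∀ π, ∀ V : Submodule ℂ (F π), IsClosed (V : Set (F π)) →
      (∀ g, ∀ v ∈ V, σ π g v ∈ V) → V = ⊥ ∨ V = ⊤)
    (hne : ∀ π π', π ≠ π' → ∀ V : F π ≃ₗᵢ[ℂ] F π', ¬ ∀ g x, V (σ π g x) = σ π' g (V x))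
    {ι : P → Type*} (H : ∀ π, ι π → Submodule ℂ E) (hHc : ∀ π i, IsClosed (H π i : Set E))
    (hHs : ∀ π i g, ∀ x ∈ H π i, ρ g x ∈ H π i)
    (U : ∀ π i, F π ≃ₗᵢ[ℂ] H π i) (hU : ∀ π i g x, ((U π i) (σ π g x) : E) = ρ g (U π i x))
    (hdense : (⨆ π, (⨆ i, H π i).topologicalClosure).topologicalClosure = ⊤)
    {Fx : Submodule ℂ E} {S : Set (Submodule ℂ E)} (hS : ∀ W ∈ S, IrreducibleOn ρ W)
    (hSo : S.Pairwise (fun W W' => W ⟂ W')) (hSd : (sSup S).topologicalClosure = Fx)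
    (hfin : ∀ W₀ ∈ S, {W ∈ S | IsUnitaryEquiv ρ W₀ W}.Finite) (π : P) [Nontrivial (F π)] :
    (⨆ j : members S H π, (j : Submodule ℂ E)) = (⨆ i, H π i).topologicalClosure ⊓ Fx := by
  obtain ⟨-, heq, -⟩ := inf_eq_sSup_of_decomposition hρ σ hσ hσirr hne H hHc hHs U hU hdense hS
    hSo hSd hfin π
  rw [heq, sSup_eq_iSup']
  rfl

/-- **«L_{π_∞} ∩ L^{K_f} = m_{K_f}(π_∞)·H_{π_∞}» as `ℂ[K]`-modules**: `S_π` is finite and the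
representation of `K` on `⨆ S_π` is, as a `ℂ[K]`-module, the product `S_π → H_π` (row 76's copies fed
to row 78's `copiesModuleEquiv`). -/
theorem finite_and_exists_copiesModuleEquiv {ρ : G →* (E →L[ℂ] E)} (hρ : ∀ g, star (ρ g) = ρ g⁻¹)
    (σ : ∀ π, G →* (F π →L[ℂ] F π)) (hσ : ∀ π g, star (σ π g) = σ π g⁻¹)
    (hσirr : ∀ π, ∀ V : Submodule ℂ (F π), IsClosed (V : Set (F π)) →
      (∀ g, ∀ v ∈ V, σ π g v ∈ V) → V = ⊥ ∨ V = ⊤)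
    (hne : ∀ π π', π ≠ π' → ∀ V : F π ≃ₗᵢ[ℂ] F π', ¬ ∀ g x, V (σ π g x) = σ π' g (V x))
    {ι : P → Type*} (H : ∀ π, ι π → Submodule ℂ E) (hHc : ∀ π i, IsClosed (H π i : Set E))
    (hHs : ∀ π i g, ∀ x ∈ H π i, ρ g x ∈ H π i)
    (U : ∀ π i, F π ≃ₗᵢ[ℂ] H π i) (hU : ∀ π i g x, ((U π i) (σ π g x) : E) = ρ g (U π i x))
    (hdense : (⨆ π, (⨆ i, H π i).topologicalClosure).topologicalClosure = ⊤)
    {Fx : Submodule ℂ E} {S : Set (Submodule ℂ E)} (hS : ∀ W ∈ S, IrreducibleOn ρ W)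
    (hSo : S.Pairwise (fun W W' => W ⟂ W')) (hSd : (sSup S).topologicalClosure = Fx)
    (hfin : ∀ W₀ ∈ S, {W ∈ S | IsUnitaryEquiv ρ W₀ W}.Finite) (π : P) [Nontrivial (F π)]
    {K : Type*} [Group K] (κ : K →* G) :
    (members S H π).Finite ∧
      Nonempty ((sumRep κ hS H π).asModule ≃ₗ[MonoidAlgebra ℂ K]
        (members S H π → (toRep ((σ π).comp κ)).asModule)) := by
  obtain ⟨hfinS, -, hcopy⟩ := inf_eq_sSup_of_decomposition hρ σ hσ hσirr hne H hHc hHs U hU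
    hdense hS hSo hSd hfin π
  refine ⟨hfinS, ?_⟩
  haveI : Fintype (members S H π) := hfinS.fintype
  let V : ∀ j : members S H π, F π ≃ₗᵢ[ℂ] (j : Submodule ℂ E) :=
    fun j => Classical.choose (hcopy j j.2)
  have hV : ∀ (j : members S H π) g x, ((V j) (σ π g x) : E) = ρ g (V j x) :=
    fun j => Classical.choose_spec (hcopy j j.2)
  have hV' : ∀ (j : members S H π) k x,
      ((V j) ((σ π).comp κ k x) : E) = (ρ.comp κ) k (V j x) := fun j k x => hV j (κ k) x
  have hW : Pairwise fun i j : members S H π => (i : Submodule ℂ E) ⟂ (j : Submodule ℂ E) :=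
    fun i j hij => hSo i.2.1 j.2.1 (fun h => hij (Subtype.ext h))
  exact ⟨copiesModuleEquiv (ρ.comp κ) ((σ π).comp κ)
    (fun j : members S H π => (j : Submodule ℂ E)) V hW hV'⟩

/-- **(A3) STEP 5 end to end: «dim π₀^{K_f}[τ] ≤ m_{K_f}(π_∞) · dim (H_{π_∞})_τ < ∞».**  In the
setting of rows 37 / 76 with a homomorphism `κ : K →* G` («K_∞ ⊂ G_∞») and a simple `ℂ[K]`-module
`T` («the K_∞-type τ») whose isotypic part in `H_π` is finite-dimensional (admissibility of `π_∞`),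
EVERY `ℂ[K]`-submodule `W'` of `L_π ⊓ L^{K_f}` (with the `K`-action `sumRep`) has a finite-dimensional
`T`-isotypic part of dimension at most `#S_π · dim_ℂ H_π[T]`, where `#S_π = m_{K_f}(π_∞)` is the
number of members of the decomposition of `L^{K_f}` lying in `L_π`. -/
theorem finite_and_finrank_isotypicComponent_le {ρ : G →* (E →L[ℂ] E)}
    (hρ : ∀ g, star (ρ g) = ρ g⁻¹)
    (σ : ∀ π, G →* (F π →L[ℂ] F π)) (hσ : ∀ π g, star (σ π g) = σ π g⁻¹)
    (hσirr : ∀ π, ∀ V : Submodule ℂ (F π), IsClosed (V : Set (F π)) →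
      (∀ g, ∀ v ∈ V, σ π g v ∈ V) → V = ⊥ ∨ V = ⊤)
    (hne : ∀ π π', π ≠ π' → ∀ V : F π ≃ₗᵢ[ℂ] F π', ¬ ∀ g x, V (σ π g x) = σ π' g (V x))
    {ι : P → Type*} (H : ∀ π, ι π → Submodule ℂ E) (hHc : ∀ π i, IsClosed (H π i : Set E))
    (hHs : ∀ π i g, ∀ x ∈ H π i, ρ g x ∈ H π i)
    (U : ∀ π i, F π ≃ₗᵢ[ℂ] H π i) (hU : ∀ π i g x, ((U π i) (σ π g x) : E) = ρ g (U π i x))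
    (hdense : (⨆ π, (⨆ i, H π i).topologicalClosure).topologicalClosure = ⊤)
    {Fx : Submodule ℂ E} {S : Set (Submodule ℂ E)} (hS : ∀ W ∈ S, IrreducibleOn ρ W)
    (hSo : S.Pairwise (fun W W' => W ⟂ W')) (hSd : (sSup S).topologicalClosure = Fx)
    (hfin : ∀ W₀ ∈ S, {W ∈ S | IsUnitaryEquiv ρ W₀ W}.Finite) (π : P) [Nontrivial (F π)]
    {K : Type*} [Group K] (κ : K →* G)
    (T : Type*) [AddCommGroup T] [Module (MonoidAlgebra ℂ K) T]
    [IsSimpleModule (MonoidAlgebra ℂ K) T]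
    [Module.Finite ℂ (isotypicComponent (MonoidAlgebra ℂ K) (toRep ((σ π).comp κ)).asModule T)]
    (W' : Submodule (MonoidAlgebra ℂ K) (sumRep κ hS H π).asModule) :
    Module.Finite ℂ (isotypicComponent (MonoidAlgebra ℂ K) W' T) ∧
      Module.finrank ℂ (isotypicComponent (MonoidAlgebra ℂ K) W' T) ≤
        Nat.card (members S H π) *
          Module.finrank ℂ (isotypicComponent (MonoidAlgebra ℂ K) (toRep ((σ π).comp κ)).asModule T) := by
  classical
  obtain ⟨hfinS, ⟨e⟩⟩ := finite_and_exists_copiesModuleEquiv hρ σ hσ hσirr hne H hHc hHs U hU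
    hdense hS hSo hSd hfin π κ
  haveI : Fintype (members S H π) := hfinS.fintype
  have key := finrank_isotypicComponent_le_of_equiv_pi (k := ℂ) T e W'
  rw [Nat.card_eq_fintype_card]
  exact key

end Decomposition

end Summit.Ventures.HodgeRepro2.T5IsotypicDimensionBound
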